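import Summits.CriticalPhenomena.SAWScalingLimit.Theorems.SAWDevelopingMapHexTransferGMHexDictionaryGeometry
import Literature.Probability.RandomPlanarGeometry.HexSAWLattice
import Literature.Probability.RandomPlanarGeometry.YangBaxterSAWHexBridges

/-!
# The `π/3` dictionary, geometric part II: the canonical discretisation of the face domain

Helper file of the line `yb-relay` for the crux `HexTransfer` (stmt-CriticalPhenomena-14221), stub
`stub_gmHexDictionary`, continuing `…GMHexDictionaryGeometry`. For the face domain
`faceDomain Ω δ a` (the `S_δ`-preimage of the interior of the union of the closed rescaled rhombi of
the face component `C` of `Ω_δ = meshFaces (π/3) Ω δ` at `a`), DCS's canonical discretisation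
`embDomainGraph hexGraph hexCenter · δ` of `HexSAW.lean` is computed exactly:

* `segment_subset_closure_faceDomain_iff` — a honeycomb edge is kept (its rescaled segment lies in
  the closure) iff the rhombi of both its triangles lie in `C` (the segment lies in the union of the
  two closed unit squares, a rectangle);
* `embMeshGraph_faceDomain_adj_iff`, `preconnected_embMeshVertexGraph_faceDomain` (the honeycomb of a
  side-connected set of rhombi is connected, so the "largest component" is everything),
  `embMeshDomain_faceDomain_eq`;
* **`hexDomainGraph_faceDomain_adj_iff`** — `Ω_δ`-adjacency = honeycomb adjacency between triangles
  of rhombi of `C`.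

Elementary; tagged [folklore].
-/

noncomputable section

namespace Summit.CriticalPhenomena.SAWScalingLimit.Cruxes.HexTransfer.YbRelay

open Set
open Complex (I)
open Literature.Probability.LatticeModels
open Literature.Probability.RandomPlanarGeometry
open Literature.Probability.RandomPlanarGeometry.SAW
open Literature.Probability.RandomPlanarGeometry.SAW.YangBaxter

/-! ### Honeycomb edges in square coordinates -/

/-- **The segment of a honeycomb edge between triangles of rhombi of `C` lies in the closure of the
interior of the union of the squares of `C`** (it lies in the union of the two closed squares, which
is a rectangle). Case `v` up, `w` down. [folklore] -/
theorem segment_sqPt_subset_of_types {C : Set Face} {x y : Site 2} (hadj : hexGraph.Adj (x, 0) (y, 1))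
    (hv : gmFace (x, 0) ∈ C) (hw : gmFace (y, 1) ∈ C) :
    segment ℝ (sqPt (x, 0)) (sqPt (y, 1)) ⊆ closure (interior (⋃ g ∈ C, sq g)) := by
  rw [hexGraph_adj_iff_coord] at hadj
  simp only [true_and, one_ne_zero, zero_ne_one, false_and, or_false] at hadj
  have hp : sqPt (x, 0) = ((x 0 : ℝ) + 1 / 3, -(x 1 : ℝ) - 1 / 3) := by
    simp only [sqPt, tOff, Fin.val_zero]; norm_num
  have hq : sqPt (y, 1) = ((y 0 : ℝ) + 2 / 3, -(y 1 : ℝ) - 2 / 3) := by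
    simp only [sqPt, tOff, Fin.val_one]; norm_num
  have hf : gmFace (x, 0) = (-(x 1) - 1, x 0) := rfl
  have hg : gmFace (y, 1) = (-(y 1) - 1, y 0) := rfl
  rw [hp, hq]
  rw [hf] at hv
  rw [hg] at hw
  -- the rectangle containing both squares
  have key : ∀ (a₁ a₂ b₁ b₂ : ℝ), (∀ r : ℝ × ℝ, r ∈ Icc a₁ a₂ ×ˢ Icc b₁ b₂ →
      r ∈ sq (-(x 1) - 1, x 0) ∨ r ∈ sq (-(y 1) - 1, y 0)) →
      ((x 0 : ℝ) + 1 / 3, -(x 1 : ℝ) - 1 / 3) ∈ Icc a₁ a₂ ×ˢ Icc b₁ b₂ →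
      ((y 0 : ℝ) + 2 / 3, -(y 1 : ℝ) - 2 / 3) ∈ Icc a₁ a₂ ×ˢ Icc b₁ b₂ →
      segment ℝ ((x 0 : ℝ) + 1 / 3, -(x 1 : ℝ) - 1 / 3) ((y 0 : ℝ) + 2 / 3, -(y 1 : ℝ) - 2 / 3) ⊆
        closure (interior (⋃ g ∈ C, sq g)) := by
    intro a₁ a₂ b₁ b₂ hbox hp hq
    refine (((convex_Icc a₁ a₂).prod (convex_Icc b₁ b₂)).segment_subset hp hq).trans fun r hr => ?_
    rcases hbox r hr with h | h
    · exact sq_subset_closure_interior hv h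
    · exact sq_subset_closure_interior hw h
  rcases hadj with ⟨h0, h1⟩ | ⟨h0, h1⟩ | ⟨h0, h1⟩
  · -- the short diagonal: same rhombus
    refine key (x 0) (x 0 + 1) (-(x 1) - 1) (-(x 1)) (fun r hr => Or.inl ?_) ?_ ?_
    · simp only [sq, mem_prod, mem_Icc] at hr ⊢; push_cast; constructor <;> constructor <;> linarith
    · simp only [mem_prod, mem_Icc]; constructor <;> constructor <;> linarith
    · simp only [mem_prod, mem_Icc, h0, h1]; constructor <;> constructor <;> linarith
  · -- across a slanted side: the rhombus to the left
    refine key (x 0 - 1) (x 0 + 1) (-(x 1) - 1) (-(x 1)) (fun r hr => ?_) ?_ ?_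
    · simp only [sq, mem_prod, mem_Icc] at hr ⊢
      push_cast
      rw [h0, h1]
      push_cast
      rcases le_or_gt r.1 (x 0) with h | h
      · right; constructor <;> constructor <;> linarith
      · left; constructor <;> constructor <;> linarith
    · simp only [mem_prod, mem_Icc]; constructor <;> constructor <;> linarith
    · simp only [mem_prod, mem_Icc, h0, h1]; push_cast; constructor <;> constructor <;> linarith
  · -- across a vertical side: the rhombus above
    refine key (x 0) (x 0 + 1) (-(x 1) - 1) (-(x 1) + 1) (fun r hr => ?_) ?_ ?_
    · simp only [sq, mem_prod, mem_Icc] at hr ⊢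
      push_cast
      rw [h0, h1]
      push_cast
      rcases le_or_gt r.2 (-(x 1)) with h | h
      · left; constructor <;> constructor <;> linarith
      · right; constructor <;> constructor <;> linarith
    · simp only [mem_prod, mem_Icc]; constructor <;> constructor <;> linarith
    · simp only [mem_prod, mem_Icc, h0, h1]; push_cast; constructor <;> constructor <;> linarith

/-- **The segment of a honeycomb edge between triangles of rhombi of `C` lies in the closure of the
interior of the union of the squares of `C`.** [folklore] -/
theorem segment_sqPt_subset {C : Set Face} {v w : HexVertex} (hadj : hexGraph.Adj v w)
    (hv : gmFace v ∈ C) (hw : gmFace w ∈ C) :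
    segment ℝ (sqPt v) (sqPt w) ⊆ closure (interior (⋃ g ∈ C, sq g)) := by
  obtain ⟨x, i⟩ := v
  obtain ⟨y, j⟩ := w
  have h := hadj
  rw [hexGraph_adj_iff_coord] at h
  rcases h with ⟨hi, hj, -⟩ | ⟨hi, hj, -⟩
  · subst hi; subst hj
    exact segment_sqPt_subset_of_types hadj hv hw
  · subst hi; subst hj
    rw [segment_symm]
    exact segment_sqPt_subset_of_types hadj.symm hw hv

/-- **A honeycomb edge is an edge of the canonical discretisation of the face domain iff the rhombi of
both its triangles lie in the face component.** [folklore] -/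
theorem segment_subset_closure_faceDomain_iff (Ω : Set ℂ) {δ : ℝ} (hδ : δ ≠ 0) (a : MidEdge)
    {v w : HexVertex} (hadj : hexGraph.Adj v w) :
    segment ℝ ((δ : ℂ) * hexCenter v) ((δ : ℂ) * hexCenter w) ⊆ closure (faceDomain Ω δ a) ↔
      gmFace v ∈ faceComp (meshFaces third Ω δ) a ∧ gmFace w ∈ faceComp (meshFaces third Ω δ) a := by
  rw [closure_faceDomain_eq Ω hδ, image_psiHomeo, mul_hexCenter_eq_psi, mul_hexCenter_eq_psi,
    ← LinearMap.coe_toAffineMap, ← image_segment, LinearMap.coe_toAffineMap,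
    image_subset_image_iff (psi_injective hδ)]
  constructor
  · intro h
    have h' := h.trans (closure_mono interior_subset)
    exact ⟨mem_of_mem_openSq_of_mem_closure (sqPt_mem_openSq v) (h' (left_mem_segment ℝ _ _)),
      mem_of_mem_openSq_of_mem_closure (sqPt_mem_openSq w) (h' (right_mem_segment ℝ _ _))⟩
  · rintro ⟨hv, hw⟩
    exact segment_sqPt_subset hadj hv hw

/-! ### The canonical discretisation of the face domain -/

section Mesh

variable (Ω : Set ℂ) {δ : ℝ} (hδ : δ ≠ 0) (a : MidEdge)
include hδ

/-- The mesh vertices of the face domain are the triangles of the rhombi of the face component.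
[folklore] -/
theorem mem_embMeshVertices_faceDomain_iff (v : HexVertex) :
    v ∈ embMeshVertices hexCenter (faceDomain Ω δ a) δ ↔ gmFace v ∈ faceComp (meshFaces third Ω δ) a :=
  mul_hexCenter_mem_faceDomain_iff Ω hδ a v

/-- **The mesh graph of the face domain is the honeycomb restricted to the triangles of the face
component.** [folklore] -/
theorem embMeshGraph_faceDomain_adj_iff (v w : HexVertex) :
    (embMeshGraph hexGraph hexCenter (faceDomain Ω δ a) δ).Adj v w ↔
      hexGraph.Adj v w ∧ gmFace v ∈ faceComp (meshFaces third Ω δ) a ∧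
        gmFace w ∈ faceComp (meshFaces third Ω δ) a := by
  rw [embMeshGraph_adj_iff]
  constructor
  · rintro ⟨h1, h2⟩
    exact ⟨h1, (segment_subset_closure_faceDomain_iff Ω hδ a h1).1 h2⟩
  · rintro ⟨h1, h2⟩
    exact ⟨h1, (segment_subset_closure_faceDomain_iff Ω hδ a h1).2 h2⟩

omit hδ in
/-- The two triangles of a rhombus are adjacent in the honeycomb. [folklore] -/
theorem hexGraph_adj_triWN_triSE (f : Face) : hexGraph.Adj (triWN f) (triSE f) := by
  rw [triWN, triSE, hexGraph_adj_iff_coord]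
  simp

/-- The triangle of the rhombus `f` containing its side `s`, as a honeycomb vertex. [folklore] -/
def triOf (f : Face) (s : Side) : HexVertex := if s.tri then triSE f else triWN f

omit hδ in
/-- The rhombus of `triOf f s` is `f`. [folklore] -/
@[simp] theorem gmFace_triOf (f : Face) (s : Side) : gmFace (triOf f s) = f := by
  unfold triOf; split_ifs <;> simp

omit hδ in
/-- **Crossing a side is a honeycomb edge**: the triangles on the two sides of a common side of two
different rhombi are adjacent. [folklore] -/
theorem hexGraph_adj_triOf {f g : Face} {s t : Side} (h : f.side s = g.side t) (hfg : f ≠ g) :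
    hexGraph.Adj (triOf f s) (triOf g t) := by
  rcases side_eq_side_cases h hfg with ⟨rfl, rfl, rfl⟩ | ⟨rfl, rfl, rfl⟩ | ⟨rfl, rfl, rfl⟩ | ⟨rfl, rfl, rfl⟩ <;>
    simp [triOf, Side.tri, triWN, triSE, hexGraph_adj_iff_coord] <;> omega

/-- Two triangles of rhombi of the face component that are honeycomb-adjacent are adjacent in the
mesh vertex graph. [folklore] -/
theorem embMeshVertexGraph_adj {v w : HexVertex} (hadj : hexGraph.Adj v w)
    (hv : gmFace v ∈ faceComp (meshFaces third Ω δ) a) (hw : gmFace w ∈ faceComp (meshFaces third Ω δ) a) :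
    (embMeshVertexGraph hexGraph hexCenter (faceDomain Ω δ a) δ).Adj
      ⟨v, (mem_embMeshVertices_faceDomain_iff Ω hδ a v).2 hv⟩
      ⟨w, (mem_embMeshVertices_faceDomain_iff Ω hδ a w).2 hw⟩ := by
  rw [SimpleGraph.induce_adj]
  exact (embMeshGraph_faceDomain_adj_iff Ω hδ a v w).2 ⟨hadj, hv, hw⟩

/-- Two triangles of the same rhombus of the face component are joined in the mesh vertex graph.
[folklore] -/
theorem embMeshVertexGraph_reachable_of_gmFace_eq {v w : HexVertex} (hvw : gmFace v = gmFace w)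
    (hv : gmFace v ∈ faceComp (meshFaces third Ω δ) a) (hw : gmFace w ∈ faceComp (meshFaces third Ω δ) a) :
    (embMeshVertexGraph hexGraph hexCenter (faceDomain Ω δ a) δ).Reachable
      ⟨v, (mem_embMeshVertices_faceDomain_iff Ω hδ a v).2 hv⟩
      ⟨w, (mem_embMeshVertices_faceDomain_iff Ω hδ a w).2 hw⟩ := by
  have hd := hexGraph_adj_triWN_triSE (gmFace v)
  rcases eq_triWN_or_triSE v with h1 | h1 <;> rcases eq_triWN_or_triSE w with h2 | h2
  · have : v = w := by rw [h1, h2, hvw]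
    subst this; rfl
  · refine SimpleGraph.Adj.reachable ?_
    rw [SimpleGraph.induce_adj]
    refine (embMeshGraph_faceDomain_adj_iff Ω hδ a v w).2 ⟨?_, hv, hw⟩
    rw [h1, h2, ← hvw]; exact hd
  · refine SimpleGraph.Adj.reachable ?_
    rw [SimpleGraph.induce_adj]
    refine (embMeshGraph_faceDomain_adj_iff Ω hδ a v w).2 ⟨?_, hv, hw⟩
    rw [h1, h2, ← hvw]; exact hd.symm
  · have : v = w := by rw [h1, h2, hvw]
    subst this; rfl

/-- Along a chain of side-adjacent rhombi of `Δ` starting in the face component, any triangle of the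
first rhombus is joined to any triangle of the last one in the mesh vertex graph. [folklore] -/
theorem embMeshVertexGraph_reachable_of_walk {f g : Face} (p : (faceAdj (meshFaces third Ω δ)).Walk f g)
    (hf : f ∈ faceComp (meshFaces third Ω δ) a) {v w : HexVertex} (hv : gmFace v = f) (hw : gmFace w = g) :
    ∃ (hv' : gmFace v ∈ faceComp (meshFaces third Ω δ) a) (hw' : gmFace w ∈ faceComp (meshFaces third Ω δ) a),
      (embMeshVertexGraph hexGraph hexCenter (faceDomain Ω δ a) δ).Reachable
        ⟨v, (mem_embMeshVertices_faceDomain_iff Ω hδ a v).2 hv'⟩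
        ⟨w, (mem_embMeshVertices_faceDomain_iff Ω hδ a w).2 hw'⟩ := by
  induction p generalizing v with
  | nil =>
    subst hw
    exact ⟨hv ▸ hf, hf, embMeshVertexGraph_reachable_of_gmFace_eq Ω hδ a hv (hv ▸ hf) hf⟩
  | @cons f f₁ g hadj p ih =>
    rw [faceAdj, SimpleGraph.fromRel_adj] at hadj
    obtain ⟨hne, hrel⟩ := hadj
    have hrel' : (∃ e : MidEdge, (∃ s, f.side s = e) ∧ ∃ t, f₁.side t = e) ∧
        f ∈ meshFaces third Ω δ ∧ f₁ ∈ meshFaces third Ω δ := by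
      rcases hrel with h | ⟨⟨e, h1, h2⟩, h3, h4⟩
      · exact h
      · exact ⟨⟨e, h2, h1⟩, h4, h3⟩
    obtain ⟨⟨e, ⟨s, hs⟩, t, ht⟩, -, hf₁Δ⟩ := hrel'
    have hf₁ : f₁ ∈ faceComp (meshFaces third Ω δ) a := by
      refine ⟨hf₁Δ, hf.2.trans (SimpleGraph.Adj.reachable ?_)⟩
      rw [faceAdj, SimpleGraph.fromRel_adj]
      exact ⟨hne, hrel⟩
    obtain ⟨h1, hw', h2⟩ := ih hf₁ (gmFace_triOf f₁ t) hw
    have hvf : gmFace v ∈ faceComp (meshFaces third Ω δ) a := hv ▸ hf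
    refine ⟨hvf, hw', ?_⟩
    refine ((embMeshVertexGraph_reachable_of_gmFace_eq Ω hδ a (hv.trans (gmFace_triOf f s).symm) hvf
      (by rw [gmFace_triOf]; exact hf)).trans (SimpleGraph.Adj.reachable ?_)).trans h2
    exact embMeshVertexGraph_adj Ω hδ a (hexGraph_adj_triOf (hs.trans ht.symm) hne) (by rw [gmFace_triOf]; exact hf) h1

/-- **The honeycomb of the face component is connected**: the mesh vertex graph of the face domain is
preconnected, so that DCS's "largest component" is all of it. [folklore] -/
theorem preconnected_embMeshVertexGraph_faceDomain :
    (embMeshVertexGraph hexGraph hexCenter (faceDomain Ω δ a) δ).Preconnected := by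
  rintro ⟨v, hv⟩ ⟨w, hw⟩
  have hv' := (mem_embMeshVertices_faceDomain_iff Ω hδ a v).1 hv
  have hw' := (mem_embMeshVertices_faceDomain_iff Ω hδ a w).1 hw
  obtain ⟨p⟩ : (faceAdj (meshFaces third Ω δ)).Reachable (gmFace v) (gmFace w) := hv'.2.symm.trans hw'.2
  obtain ⟨_, _, h⟩ := embMeshVertexGraph_reachable_of_walk Ω hδ a p hv' rfl rfl
  exact h

/-- **The discrete domain is the whole mesh vertex set.** [folklore] -/
theorem embMeshDomain_faceDomain_eq :
    embMeshDomain hexGraph hexCenter (faceDomain Ω δ a) δ = embMeshVertices hexCenter (faceDomain Ω δ a) δ := by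
  refine (embMeshDomain_subset _ _ _ _).antisymm fun v hv => ?_
  haveI := (preconnected_embMeshVertexGraph_faceDomain Ω hδ a).subsingleton_connectedComponent
  simp only [embMeshDomain, mem_iUnion, mem_image]
  refine ⟨(embMeshVertexGraph hexGraph hexCenter (faceDomain Ω δ a) δ).connectedComponentMk ⟨v, hv⟩,
    fun C' => by rw [Subsingleton.elim C' _], ⟨v, hv⟩, ?_, rfl⟩
  rw [SimpleGraph.ConnectedComponent.mem_supp_iff]

/-- **The canonical hexagonal discretisation of the face domain is the honeycomb of the face
component**: two honeycomb vertices are adjacent in `(faceDomain Ω δ a)_δ` iff they are adjacent in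
the honeycomb and the rhombi carrying them lie in the face component of `Ω_δ` at `a`. [folklore] -/
theorem hexDomainGraph_faceDomain_adj_iff (v w : HexVertex) :
    (hexDomainGraph (faceDomain Ω δ a) δ).Adj v w ↔
      hexGraph.Adj v w ∧ gmFace v ∈ faceComp (meshFaces third Ω δ) a ∧
        gmFace w ∈ faceComp (meshFaces third Ω δ) a := by
  rw [hexDomainGraph, embDomainGraph_adj_iff, embMeshDomain_faceDomain_eq Ω hδ a, embMeshGraph_faceDomain_adj_iff Ω hδ a,
    mem_embMeshVertices_faceDomain_iff Ω hδ a, mem_embMeshVertices_faceDomain_iff Ω hδ a]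
  tauto

end Mesh

/-- **Main statement of this file (registered sub-goal of `stub_gmHexDictionary`)**: the canonical
hexagonal discretisation of the face domain is the honeycomb of the face component. [folklore] -/
theorem hexDomainGraph_faceDomain_adj_iff_gmFace : ∀ (Ω : Set ℂ) (δ : ℝ), δ ≠ 0 → ∀ (a : MidEdge) (v w : HexVertex), (hexDomainGraph (faceDomain Ω δ a) δ).Adj v w ↔ hexGraph.Adj v w ∧ gmFace v ∈ faceComp (meshFaces third Ω δ) a ∧ gmFace w ∈ faceComp (meshFaces third Ω δ) a := by
  intro Ω δ hδ a v w
  exact hexDomainGraph_faceDomain_adj_iff Ω hδ a v w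

end Summit.CriticalPhenomena.SAWScalingLimit.Cruxes.HexTransfer.YbRelay

end
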